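import Mathlib
import Literature.Analysis.FluidPDE.IsometryInvariance
import Summits.NavierStokesRegularity.NavierStokesRegularity.Theorems.PlaneEnergyCeilingSlabEnergyIdentityPointwise
import Summits.NavierStokesRegularity.NavierStokesRegularity.Theorems.PlaneEnergyCeilingPlanarEnergyAPrioriSlabLawDecay
import Summits.NavierStokesRegularity.NavierStokesRegularity.Theorems.PlaneEnergyCeilingPlanarEnergyAPrioriPlanarFlux
import Summits.NavierStokesRegularity.NavierStokesRegularity.Theorems.PlaneEnergyCeilingPlanarEnergyAPrioriFluxLedgerDir

/-!
# Route PlaneEnergyCeiling · crux `PlanarEnergyAPriori` — the Bernoulli flux difference as a volume integral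

Helper file for the crux item stmt-NavierStokesRegularity-16855 (`PlanarEnergyAPriori`), landed
`--supports` that item: the second input of the FLUX VARIATION BOUND (strategist census gen 1,
A-S6 (F1)). For a `C¹` divergence-free field `u` and a `C¹` scalar `p` on `ℝ³` with order-(3,2)
decay (`‖u‖, ‖Du‖ ≤ C(1+‖x‖)⁻³`, `|p|, ‖Dp‖ ≤ C(1+‖x‖)⁻²`), the Bernoulli flux
`F(R,c) = ∫_{R({x₂=c})} (|u|²/2 + p) ⟪u, R e₂⟫ dA` through the planes of any direction `R`
satisfies

* `bernoulliFlux_sub_eq_setIntegral` — in the coordinate direction,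
  `F(b) − F(a) = ∫_{a<x₂<b} (⟪u, (u·∇)u⟫ + ⟪u, ∇p⟫) dx` (`a ≤ b`): the divergence theorem on the slab
  (`sum_setIntegral_slab_fderiv`) for the field `(|u|²/2 + p)u`, whose divergence is
  `⟪u, ∇(|u|²/2 + p)⟫` since `div u = 0` (`sum_fderiv_bernoulli_mul`);
* `enorm_bernoulliFlux_sub_le` — in EVERY direction, the bound
  `‖F(R,a) − F(R,b)‖ ≤ ∫ ‖u‖² ‖Du‖ + ∫ ‖u‖ ‖Dp‖` (in `ℝ≥0∞`), by rotation covariance (the conjugate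
  pair `(R⁻¹ u R, p R)` has the same decay and its coordinate flux is the flux of `(u,p)` through the
  planes normal to `R e₂`) and `|⟪u,(u·∇)u⟫ + ⟪u,∇p⟫| ≤ ‖u‖²‖Du‖ + ‖u‖‖Dp‖`;
* `enorm_bernoulliFlux_sub_le_closedForm` — the registered closed form.

So the oscillation of the flux in the offset is controlled by two VOLUME integrals, which the
slice-wise Ladyzhenskaya inequality and the Calderón–Zygmund bound for `∇p` turn into
`C √(P_R) ‖Du‖₂²`. Folklore.
-/

noncomputable section

-- single-conjunct summit: `Summit.<Summit>.<Problem>` repeats the name by the D-0017 layout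
set_option linter.dupNamespace false

namespace Summit.NavierStokesRegularity.NavierStokesRegularity.Theorems.PlanarEnergyAPriori

open MeasureTheory Set Filter Topology Function WithLp
open scoped ENNReal RealInnerProductSpace
open Literature.Analysis.FluidPDE
open Summit.NavierStokesRegularity.NavierStokesRegularity.Theorems.PlaneEnergyCeilingSlabEnergyIdentity
open Summit.NavierStokesRegularity.NavierStokesRegularity.Theorems.PlanarEnergyAPriori.SlabLaw

variable {u : EuclideanSpace ℝ (Fin 3) → EuclideanSpace ℝ (Fin 3)} {p : EuclideanSpace ℝ (Fin 3) → ℝ} {C : ℝ}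

/-! ### The coordinate direction: divergence theorem on the slab -/

/-- **The flux difference is the slab integral of `⟪u, ∇(|u|²/2 + p)⟫`.** For `C¹` divergence-free
`u` and `C¹` `p` with order-(3,2) decay and `a ≤ b`:
`F(b) − F(a) = ∫_{a<x₂<b} (⟪u, (u·∇)u⟫ + ⟪u, ∇p⟫) dx`, `F(c) = ∫_{ℝ²} (|u|²/2 + p) u₂ (y₀,y₁,c) dy`.
[folklore] -/
theorem bernoulliFlux_sub_eq_setIntegral (hu : ContDiff ℝ 1 u) (hp : ContDiff ℝ 1 p)
    (hdiv : VectorCalculus.IsDivFree u)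
    (h0 : ∀ x, ‖u x‖ ≤ C * (1 + ‖x‖) ^ (-(3 : ℝ))) (h1 : ∀ x, ‖fderiv ℝ u x‖ ≤ C * (1 + ‖x‖) ^ (-(3 : ℝ)))
    (k0 : ∀ x, ‖p x‖ ≤ C * (1 + ‖x‖) ^ (-(2 : ℝ))) (k1 : ∀ x, ‖fderiv ℝ p x‖ ≤ C * (1 + ‖x‖) ^ (-(2 : ℝ)))
    {a b : ℝ} (hab : a ≤ b) :
    (∫ y : EuclideanSpace ℝ (Fin 2), (‖u (toLp 2 ![y 0, y 1, b])‖ ^ 2 / 2 + p (toLp 2 ![y 0, y 1, b])) *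
        u (toLp 2 ![y 0, y 1, b]) 2) -
      ∫ y : EuclideanSpace ℝ (Fin 2), (‖u (toLp 2 ![y 0, y 1, a])‖ ^ 2 / 2 + p (toLp 2 ![y 0, y 1, a])) *
        u (toLp 2 ![y 0, y 1, a]) 2 =
      ∫ x in {x : EuclideanSpace ℝ (Fin 3) | a < x 2 ∧ x 2 < b}, (⟪u x, convect u u x⟫ + ⟪u x, gradient p x⟫) := by
  have hC : 0 ≤ C := nonneg_of_norm_le_rpow h0
  set φ : Fin 3 → EuclideanSpace ℝ (Fin 3) → ℝ := fun j z => (‖u z‖ ^ 2 / 2 + p z) * u z j with hφ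
  have hφ1 : ∀ j, ContDiff ℝ 1 (φ j) := fun j => contDiff_bernoulli_mul hu hp j
  have hint₀ : ∀ j, Integrable (φ j) := fun j => integrable_bernoulli_mul' hu hp h0 k0 j
  have hint : ∀ j, Integrable fun x => fderiv ℝ (φ j) x (EuclideanSpace.single j 1) := fun j =>
    integrable_fderiv_bernoulli_mul' hu hp h0 h1 k0 k1 j
  have hslice : ∀ c, Integrable fun y : EuclideanSpace ℝ (Fin 2) => φ 2 (toLp 2 ![y 0, y 1, c]) := fun c =>
    integrable_plane_of_norm_le_rpow (hφ1 2).continuous (by norm_num : (2 : ℝ) < 5)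
      (fun x => norm_bernoulli_mul_le_weight hC (h0 x) (k0 x) 2) c
  have key := sum_setIntegral_slab_fderiv hφ1 hint₀ hint hab (hslice a) (hslice b)
  simp only [hφ] at key
  rw [← key, ← integral_finsetSum _ fun j _ => (hint j).integrableOn]
  refine integral_congr_ae (ae_of_all _ fun x => ?_)
  exact sum_fderiv_bernoulli_mul (hu.differentiable one_ne_zero) (hp.differentiable one_ne_zero) hdiv x

/-- Pointwise: `|⟪u, (u·∇)u⟫ + ⟪u, ∇p⟫| ≤ ‖u‖² ‖Du‖ + ‖u‖ ‖Dp‖` (in `ℝ≥0∞`). -/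
theorem enorm_inner_convect_add_inner_gradient_le (u : EuclideanSpace ℝ (Fin 3) → EuclideanSpace ℝ (Fin 3))
    (p : EuclideanSpace ℝ (Fin 3) → ℝ) (x : EuclideanSpace ℝ (Fin 3)) :
    ‖⟪u x, convect u u x⟫ + ⟪u x, gradient p x⟫‖ₑ ≤
      ‖u x‖ₑ ^ 2 * ‖fderiv ℝ u x‖ₑ + ‖u x‖ₑ * ‖fderiv ℝ p x‖ₑ := by
  have h1 : ‖⟪u x, convect u u x⟫‖ ≤ ‖u x‖ ^ 2 * ‖fderiv ℝ u x‖ := by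
    rw [convect_apply]
    calc _ ≤ ‖u x‖ * ‖fderiv ℝ u x (u x)‖ := norm_inner_le_norm _ _
      _ ≤ ‖u x‖ * (‖fderiv ℝ u x‖ * ‖u x‖) := by gcongr; exact ContinuousLinearMap.le_opNorm _ _
      _ = _ := by ring
  have h2 : ‖⟪u x, gradient p x⟫‖ ≤ ‖u x‖ * ‖fderiv ℝ p x‖ := by
    calc _ ≤ ‖u x‖ * ‖gradient p x‖ := norm_inner_le_norm _ _
      _ = _ := by rw [norm_fderiv_eq_norm_gradient]
  calc ‖⟪u x, convect u u x⟫ + ⟪u x, gradient p x⟫‖ₑ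
      ≤ ‖⟪u x, convect u u x⟫‖ₑ + ‖⟪u x, gradient p x⟫‖ₑ := enorm_add_le _ _
    _ ≤ ‖u x‖ₑ ^ 2 * ‖fderiv ℝ u x‖ₑ + ‖u x‖ₑ * ‖fderiv ℝ p x‖ₑ := by
        gcongr
        · rw [← ofReal_norm, ← ofReal_norm, ← ofReal_norm, ← ENNReal.ofReal_pow (norm_nonneg _),
            ← ENNReal.ofReal_mul (by positivity)]
          exact ENNReal.ofReal_le_ofReal h1
        · rw [← ofReal_norm, ← ofReal_norm, ← ofReal_norm, ← ENNReal.ofReal_mul (norm_nonneg _)]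
          exact ENNReal.ofReal_le_ofReal h2

/-- The coordinate-direction bound: `‖F(b) − F(a)‖ ≤ ∫ ‖u‖²‖Du‖ + ∫ ‖u‖‖Dp‖` for `a ≤ b`. -/
theorem enorm_bernoulliFlux_sub_le_coord (hu : ContDiff ℝ 1 u) (hp : ContDiff ℝ 1 p)
    (hdiv : VectorCalculus.IsDivFree u)
    (h0 : ∀ x, ‖u x‖ ≤ C * (1 + ‖x‖) ^ (-(3 : ℝ))) (h1 : ∀ x, ‖fderiv ℝ u x‖ ≤ C * (1 + ‖x‖) ^ (-(3 : ℝ)))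
    (k0 : ∀ x, ‖p x‖ ≤ C * (1 + ‖x‖) ^ (-(2 : ℝ))) (k1 : ∀ x, ‖fderiv ℝ p x‖ ≤ C * (1 + ‖x‖) ^ (-(2 : ℝ)))
    {a b : ℝ} (hab : a ≤ b) :
    ‖(∫ y : EuclideanSpace ℝ (Fin 2), (‖u (toLp 2 ![y 0, y 1, b])‖ ^ 2 / 2 + p (toLp 2 ![y 0, y 1, b])) *
        u (toLp 2 ![y 0, y 1, b]) 2) -
      ∫ y : EuclideanSpace ℝ (Fin 2), (‖u (toLp 2 ![y 0, y 1, a])‖ ^ 2 / 2 + p (toLp 2 ![y 0, y 1, a])) *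
        u (toLp 2 ![y 0, y 1, a]) 2‖ₑ ≤
      (∫⁻ x, ‖u x‖ₑ ^ 2 * ‖fderiv ℝ u x‖ₑ) + ∫⁻ x, ‖u x‖ₑ * ‖fderiv ℝ p x‖ₑ := by
  rw [bernoulliFlux_sub_eq_setIntegral hu hp hdiv h0 h1 k0 k1 hab]
  have hmu : Measurable fun x => ‖u x‖ₑ ^ 2 * ‖fderiv ℝ u x‖ₑ :=
    ((continuous_enorm.comp hu.continuous).measurable.pow_const 2).mul
      (continuous_enorm.comp (hu.continuous_fderiv one_ne_zero)).measurable
  calc _ ≤ ∫⁻ x in {x : EuclideanSpace ℝ (Fin 3) | a < x 2 ∧ x 2 < b}, ‖⟪u x, convect u u x⟫ + ⟪u x, gradient p x⟫‖ₑ :=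
        enorm_integral_le_lintegral_enorm _
    _ ≤ ∫⁻ x, ‖⟪u x, convect u u x⟫ + ⟪u x, gradient p x⟫‖ₑ := setLIntegral_le_lintegral _ _
    _ ≤ ∫⁻ x, (‖u x‖ₑ ^ 2 * ‖fderiv ℝ u x‖ₑ + ‖u x‖ₑ * ‖fderiv ℝ p x‖ₑ) :=
        lintegral_mono fun x => enorm_inner_convect_add_inner_gradient_le u p x
    _ = _ := lintegral_add_left hmu _

/-! ### Every direction: rotation covariance -/

/-- **The flux difference bound through every plane.** For `C¹` divergence-free `u` and `C¹` `p`
with order-(3,2) decay, every linear isometry `R` and all offsets `a`, `b`: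
`‖F(R,a) − F(R,b)‖ ≤ ∫ ‖u‖² ‖Du‖ + ∫ ‖u‖ ‖Dp‖` (in `ℝ≥0∞`),
`F(R,c) = ∫_{ℝ²} (|u|²/2 + p)⟪u, R e₂⟫ (R(y₀,y₁,c)) dy`. (Conjugate pair `v = R⁻¹ u R`, `q = p R`:
same decay, coordinate flux of `(v,q)` = flux of `(u,p)` through `R({x₂ = c})`, and the volume
integrals are rotation invariant.) [folklore] -/
theorem enorm_bernoulliFlux_sub_le (hu : ContDiff ℝ 1 u) (hp : ContDiff ℝ 1 p)
    (hdiv : VectorCalculus.IsDivFree u)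
    (h0 : ∀ x, ‖u x‖ ≤ C * (1 + ‖x‖) ^ (-(3 : ℝ))) (h1 : ∀ x, ‖fderiv ℝ u x‖ ≤ C * (1 + ‖x‖) ^ (-(3 : ℝ)))
    (k0 : ∀ x, ‖p x‖ ≤ C * (1 + ‖x‖) ^ (-(2 : ℝ))) (k1 : ∀ x, ‖fderiv ℝ p x‖ ≤ C * (1 + ‖x‖) ^ (-(2 : ℝ)))
    (R : EuclideanSpace ℝ (Fin 3) ≃ₗᵢ[ℝ] EuclideanSpace ℝ (Fin 3)) (a b : ℝ) :
    ‖(∫ y : EuclideanSpace ℝ (Fin 2), (‖u (R (toLp 2 ![y 0, y 1, a]))‖ ^ 2 / 2 + p (R (toLp 2 ![y 0, y 1, a]))) *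
        ⟪u (R (toLp 2 ![y 0, y 1, a])), R (EuclideanSpace.single 2 1)⟫) -
      ∫ y : EuclideanSpace ℝ (Fin 2), (‖u (R (toLp 2 ![y 0, y 1, b]))‖ ^ 2 / 2 + p (R (toLp 2 ![y 0, y 1, b]))) *
        ⟪u (R (toLp 2 ![y 0, y 1, b])), R (EuclideanSpace.single 2 1)⟫‖ₑ ≤
      (∫⁻ x, ‖u x‖ₑ ^ 2 * ‖fderiv ℝ u x‖ₑ) + ∫⁻ x, ‖u x‖ₑ * ‖fderiv ℝ p x‖ₑ := by
  -- the conjugate pair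
  set v : EuclideanSpace ℝ (Fin 3) → EuclideanSpace ℝ (Fin 3) := fun x => R.symm (u (R.symm.symm x)) with hv
  set q : EuclideanSpace ℝ (Fin 3) → ℝ := fun x => p (R.symm.symm x) with hq
  have hvu : ∀ x, v x = R.symm (u (R x)) := fun x => by simp [hv]
  have hqp : ∀ x, q x = p (R x) := fun x => by simp [hq]
  have hv1 : ContDiff ℝ 1 v := by rw [hv]; exact R.symm.contDiff.comp (hu.comp R.symm.symm.contDiff)
  have hq1 : ContDiff ℝ 1 q := by rw [hq]; exact hp.comp R.symm.symm.contDiff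
  have hvdiv : VectorCalculus.IsDivFree v := hdiv.conj_linearIsometryEquiv (R := R.symm)
  have hDv : ∀ x, ‖fderiv ℝ v x‖ = ‖fderiv ℝ u (R x)‖ := fun x => by
    have : v = fun y => R.symm (u (R.symm.symm y)) := rfl
    rw [this, fderiv_conj_linearIsometryEquiv, ContinuousLinearMap.opNorm_linearIsometryEquiv_comp,
      ContinuousLinearMap.opNorm_comp_linearIsometryEquiv]
    simp
  have hDq : ∀ x, ‖fderiv ℝ q x‖ = ‖fderiv ℝ p (R x)‖ := fun x => by
    have : q = fun y => p (R.symm.symm y) := rfl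
    rw [this, fderiv_comp_linearIsometryEquiv_symm, ContinuousLinearMap.opNorm_comp_linearIsometryEquiv]
    simp
  have h0' : ∀ x, ‖v x‖ ≤ C * (1 + ‖x‖) ^ (-(3 : ℝ)) := fun x => by
    rw [hvu, LinearIsometryEquiv.norm_map]; simpa [LinearIsometryEquiv.norm_map] using h0 (R x)
  have h1' : ∀ x, ‖fderiv ℝ v x‖ ≤ C * (1 + ‖x‖) ^ (-(3 : ℝ)) := fun x => by
    rw [hDv]; simpa [LinearIsometryEquiv.norm_map] using h1 (R x)
  have k0' : ∀ x, ‖q x‖ ≤ C * (1 + ‖x‖) ^ (-(2 : ℝ)) := fun x => by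
    rw [hqp]; simpa [LinearIsometryEquiv.norm_map] using k0 (R x)
  have k1' : ∀ x, ‖fderiv ℝ q x‖ ≤ C * (1 + ‖x‖) ^ (-(2 : ℝ)) := fun x => by
    rw [hDq]; simpa [LinearIsometryEquiv.norm_map] using k1 (R x)
  -- the coordinate flux of `(v,q)` is the flux of `(u,p)` through `R({x₂ = c})`
  have hflux : ∀ c, ∫ y : EuclideanSpace ℝ (Fin 2), (‖v (toLp 2 ![y 0, y 1, c])‖ ^ 2 / 2 + q (toLp 2 ![y 0, y 1, c])) *
        v (toLp 2 ![y 0, y 1, c]) 2 =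
      ∫ y : EuclideanSpace ℝ (Fin 2), (‖u (R (toLp 2 ![y 0, y 1, c]))‖ ^ 2 / 2 + p (R (toLp 2 ![y 0, y 1, c]))) *
        ⟪u (R (toLp 2 ![y 0, y 1, c])), R (EuclideanSpace.single 2 1)⟫ := by
    intro c
    refine integral_congr_ae (ae_of_all _ fun y => ?_)
    dsimp only
    rw [hvu, hqp, LinearIsometryEquiv.norm_map]
    have hv2 : (R.symm (u (R (toLp 2 ![y 0, y 1, c])))) 2 =
        ⟪u (R (toLp 2 ![y 0, y 1, c])), R (EuclideanSpace.single 2 1)⟫ := by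
      have : (R.symm (u (R (toLp 2 ![y 0, y 1, c])))) 2 =
          ⟪R.symm (u (R (toLp 2 ![y 0, y 1, c]))), EuclideanSpace.single 2 1⟫ := by
        simp [EuclideanSpace.inner_single_right]
      rw [this]
      conv_lhs => rw [← LinearIsometryEquiv.inner_map_map R, LinearIsometryEquiv.apply_symm_apply]
    rw [hv2]
  -- the volume integrals are rotation invariant
  have hmu : Measurable fun x => ‖u x‖ₑ ^ 2 * ‖fderiv ℝ u x‖ₑ :=
    ((continuous_enorm.comp hu.continuous).measurable.pow_const 2).mul
      (continuous_enorm.comp (hu.continuous_fderiv one_ne_zero)).measurable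
  have hmp : Measurable fun x => ‖u x‖ₑ * ‖fderiv ℝ p x‖ₑ :=
    (continuous_enorm.comp hu.continuous).measurable.mul
      (continuous_enorm.comp (hp.continuous_fderiv one_ne_zero)).measurable
  have hI1 : ∫⁻ x, ‖v x‖ₑ ^ 2 * ‖fderiv ℝ v x‖ₑ = ∫⁻ x, ‖u x‖ₑ ^ 2 * ‖fderiv ℝ u x‖ₑ := by
    have hpt : (fun x => ‖v x‖ₑ ^ 2 * ‖fderiv ℝ v x‖ₑ) =
        fun x => (fun z => ‖u z‖ₑ ^ 2 * ‖fderiv ℝ u z‖ₑ) (R x) := by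
      funext x
      dsimp only
      rw [hvu, ← ofReal_norm (R.symm _), LinearIsometryEquiv.norm_map, ofReal_norm,
        ← ofReal_norm (fderiv ℝ v x), hDv, ofReal_norm]
    rw [hpt]
    exact R.measurePreserving.lintegral_comp hmu
  have hI2 : ∫⁻ x, ‖v x‖ₑ * ‖fderiv ℝ q x‖ₑ = ∫⁻ x, ‖u x‖ₑ * ‖fderiv ℝ p x‖ₑ := by
    have hpt : (fun x => ‖v x‖ₑ * ‖fderiv ℝ q x‖ₑ) = fun x => (fun z => ‖u z‖ₑ * ‖fderiv ℝ p z‖ₑ) (R x) := by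
      funext x
      dsimp only
      rw [hvu, ← ofReal_norm (R.symm _), LinearIsometryEquiv.norm_map, ofReal_norm,
        ← ofReal_norm (fderiv ℝ q x), hDq, ofReal_norm]
    rw [hpt]
    exact R.measurePreserving.lintegral_comp hmp
  -- conclude, ordering the offsets
  rw [← hflux a, ← hflux b, ← hI1, ← hI2]
  rcases le_total a b with hab | hba
  · rw [← enorm_neg, neg_sub]
    exact enorm_bernoulliFlux_sub_le_coord hv1 hq1 hvdiv h0' h1' k0' k1' hab
  · exact enorm_bernoulliFlux_sub_le_coord hv1 hq1 hvdiv h0' h1' k0' k1' hba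

/-- **The flux difference bound through every plane** (registered closed form, sub-goal
`enorm_bernoulliFlux_sub_le_closedForm` of stmt-NavierStokesRegularity-16855): for `C¹`
divergence-free `u` and `C¹` `p` on `ℝ³` with `‖u‖, ‖Du‖ ≤ C(1+‖x‖)⁻³` and `|p|, ‖Dp‖ ≤ C(1+‖x‖)⁻²`,
every linear isometry `R` and all offsets `a, b`, the Bernoulli fluxes
`F(R,c) = ∫ (|u|²/2 + p)⟪u, R e₂⟫ ∘ R(y₀,y₁,c) dy` satisfy
`‖F(R,a) − F(R,b)‖ₑ ≤ ∫⁻ ‖u‖ₑ² ‖Du‖ₑ + ∫⁻ ‖u‖ₑ ‖Dp‖ₑ`. [folklore] -/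
theorem enorm_bernoulliFlux_sub_le_closedForm : ∀ (u : EuclideanSpace ℝ (Fin 3) → EuclideanSpace ℝ (Fin 3)) (p : EuclideanSpace ℝ (Fin 3) → ℝ) (C : ℝ), ContDiff ℝ 1 u → ContDiff ℝ 1 p → Literature.Analysis.FluidPDE.VectorCalculus.IsDivFree u → (∀ x, ‖u x‖ ≤ C * (1 + ‖x‖) ^ (-(3 : ℝ))) → (∀ x, ‖fderiv ℝ u x‖ ≤ C * (1 + ‖x‖) ^ (-(3 : ℝ))) → (∀ x, ‖p x‖ ≤ C * (1 + ‖x‖) ^ (-(2 : ℝ))) → (∀ x, ‖fderiv ℝ p x‖ ≤ C * (1 + ‖x‖) ^ (-(2 : ℝ))) → ∀ (R : EuclideanSpace ℝ (Fin 3) ≃ₗᵢ[ℝ] EuclideanSpace ℝ (Fin 3)) (a b : ℝ), ‖(∫ y : EuclideanSpace ℝ (Fin 2), (‖u (R (WithLp.toLp 2 ![y 0, y 1, a]))‖ ^ 2 / 2 + p (R (WithLp.toLp 2 ![y 0, y 1, a]))) * inner ℝ (u (R (WithLp.toLp 2 ![y 0, y 1, a]))) (R (EuclideanSpace.single 2 1)))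 - (∫ y : EuclideanSpace ℝ (Fin 2), (‖u (R (WithLp.toLp 2 ![y 0, y 1, b]))‖ ^ 2 / 2 + p (R (WithLp.toLp 2 ![y 0, y 1, b]))) * inner ℝ (u (R (WithLp.toLp 2 ![y 0, y 1, b]))) (R (EuclideanSpace.single 2 1)))‖ₑ ≤ (∫⁻ x, ‖u x‖ₑ ^ 2 * ‖fderiv ℝ u x‖ₑ) + ∫⁻ x, ‖u x‖ₑ * ‖fderiv ℝ p x‖ₑ :=
  fun _ _ _ hu hp hdiv h0 h1 k0 k1 R a b => enorm_bernoulliFlux_sub_le hu hp hdiv h0 h1 k0 k1 R a b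

end Summit.NavierStokesRegularity.NavierStokesRegularity.Theorems.PlanarEnergyAPriori

end
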